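import Mathlib
import Summits.RiemannHypothesis.RiemannHypothesis.Theorems.WeilParityOffLineParityDetectionTrialIntegrals
import Literature.Analysis.Calculus.LogCutoff
import Literature.NumberTheory.LFunctions.WeilGroundEnergyParitySplit
import Literature.NumberTheory.LFunctions.WeilMellinBounds
import HarnessLib

/-!
# The plateau cut-off and the odd trial function `χ(t) sinh(ηt) cos(γt)`

Route `WeilParity`, crux `OffLineParityDetection` (item stmt-RiemannHypothesis-15431), line
`registered`, stub `stub_dominantQuadrupleOddTrial` (TRIAL).  Pure real-analysis helper file (no
zeta facts, no definitions; everything is exported existentially):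

* `trial_hasDerivAt_deriv_cutoff`, `trial_exists_bound_deriv_deriv_cutoff` — the second
  derivative of the tree's unit plateau `Literature.Analysis.Calculus.cutoff R`
  (`= sT(s + R) sT(R - s)`, `sT` Mathlib's `Real.smoothTransition`) and a bound for it uniform in
  `R` (from the tree's common bound for `sT'`, `sT''`);
* `trial_exists_plateau` — for every half-width `a` and transition width `δ > 0` a smooth EVEN
  plateau `χ` with values in `[0, 1]`, `χ = 1` on `|t| ≤ a - δ`, `χ = 0` on `|t| ≥ a`,
  `|χ'| ≤ C/δ`, `|χ''| ≤ C/δ²` with ONE constant `C` (rescale `cutoff (a/δ)` by `δ`);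
* `trial_exists_oddTest_basic` — the odd trial function `o(t) = χ(t) sinh(ηt) cos(γt)` (as a
  complex-valued Weil test): smooth of compact support in `[-a, a]`, odd, real-valued, nonzero in
  `L²`, with `∫ |o| ≤ 2a sinh(ηa)` and `∫ |o''| ≤ C a cosh(ηa)` for a constant `C = C(η, γ, δ)`
  independent of the window `a ≥ 1`.

Everything is folklore calculus and fully proved.
-/

set_option linter.dupNamespace false

noncomputable section

namespace Summit.RiemannHypothesis.RiemannHypothesis.Theorems.WeilParityOffLineParityDetection

open MeasureTheory Set Real
open scoped ContDiff
open Literature.NumberTheory.LFunctions Literature.Analysis.Calculus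

/-! ## The second derivative of the unit plateau -/

/-- The second derivative of `cutoff R s = sT(s + R) sT(R - s)`:
`(cutoff R)'' s = sT''(s+R) sT(R-s) - 2 sT'(s+R) sT'(R-s) + sT(s+R) sT''(R-s)`. [folklore] -/
theorem trial_hasDerivAt_deriv_cutoff (R s : ℝ) :
    HasDerivAt (deriv (cutoff R))
      (deriv (deriv smoothTransition) (s + R) * smoothTransition (R - s) +
          deriv smoothTransition (s + R) * -deriv smoothTransition (R - s) -
        (deriv smoothTransition (s + R) * deriv smoothTransition (R - s) +
          smoothTransition (s + R) * -deriv (deriv smoothTransition) (R - s))) s := by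
  have hfun : deriv (cutoff R) = fun s ↦ deriv smoothTransition (s + R) * smoothTransition (R - s) -
      smoothTransition (s + R) * deriv smoothTransition (R - s) := funext (deriv_cutoff R)
  rw [hfun]
  have hd : Differentiable ℝ (deriv smoothTransition) :=
    contDiff_deriv_smoothTransition.differentiable (by simp)
  have h1 : HasDerivAt (fun s ↦ deriv smoothTransition (s + R))
      (deriv (deriv smoothTransition) (s + R)) s := (hd (s + R)).hasDerivAt.comp_add_const s R
  have h2 : HasDerivAt (fun s ↦ smoothTransition (R - s)) (-deriv smoothTransition (R - s)) s :=
    (differentiable_smoothTransition (R - s)).hasDerivAt.comp_const_sub R s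
  have h3 : HasDerivAt (fun s ↦ smoothTransition (s + R)) (deriv smoothTransition (s + R)) s :=
    (differentiable_smoothTransition (s + R)).hasDerivAt.comp_add_const s R
  have h4 : HasDerivAt (fun s ↦ deriv smoothTransition (R - s))
      (-deriv (deriv smoothTransition) (R - s)) s := (hd (R - s)).hasDerivAt.comp_const_sub R s
  exact (h1.fun_mul h2).fun_sub (h3.fun_mul h4)

/-- **Uniform bounds for `(cutoff R)'` and `(cutoff R)''`**, independent of `R`. [folklore] -/
theorem trial_exists_bound_deriv_deriv_cutoff :
    ∃ D : ℝ, 0 ≤ D ∧ (∀ R s, |deriv (cutoff R) s| ≤ D) ∧ ∀ R s, |deriv (deriv (cutoff R)) s| ≤ D := by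
  obtain ⟨D₁, hD₁0, hD₁⟩ := exists_bound_deriv_cutoff
  obtain ⟨C, hC0, hC1, hC2⟩ := exists_abs_deriv_and_deriv_deriv_smoothTransition_le
  refine ⟨D₁ + (2 * C + 2 * C ^ 2), by positivity, fun R s ↦ (hD₁ R s).trans (by nlinarith),
    fun R s ↦ ?_⟩
  rw [(trial_hasDerivAt_deriv_cutoff R s).deriv]
  have hS0 : ∀ x, |smoothTransition x| ≤ 1 := fun x ↦ by
    rw [abs_of_nonneg (smoothTransition.nonneg x)]
    exact smoothTransition.le_one x
  have e1 : |deriv (deriv smoothTransition) (s + R) * smoothTransition (R - s)| ≤ C * 1 := by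
    rw [abs_mul]; exact mul_le_mul (hC2 _) (hS0 _) (abs_nonneg _) hC0
  have e2 : |deriv smoothTransition (s + R) * -deriv smoothTransition (R - s)| ≤ C * C := by
    rw [abs_mul, abs_neg]; exact mul_le_mul (hC1 _) (hC1 _) (abs_nonneg _) hC0
  have e3 : |deriv smoothTransition (s + R) * deriv smoothTransition (R - s)| ≤ C * C := by
    rw [abs_mul]; exact mul_le_mul (hC1 _) (hC1 _) (abs_nonneg _) hC0
  have e4 : |smoothTransition (s + R) * -deriv (deriv smoothTransition) (R - s)| ≤ 1 * C := by
    rw [abs_mul, abs_neg]; exact mul_le_mul (hS0 _) (hC2 _) (abs_nonneg _) zero_le_one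
  have hsum := abs_sub _ _ |>.trans (add_le_add ((abs_add_le _ _).trans (add_le_add e1 e2))
    ((abs_add_le _ _).trans (add_le_add e3 e4)))
  nlinarith [hsum]

/-! ## The plateau of half-width `a` and transition width `δ` -/

/-- **The smooth even plateau.** There is ONE constant `C > 0` such that for every half-width `a`
and every transition width `δ > 0` there is a `C^∞` even function `χ : ℝ → ℝ` with values in
`[0, 1]`, `χ = 1` on `|t| ≤ a - δ`, `χ = 0` on `|t| ≥ a`, `|χ'| ≤ C/δ` and `|χ''| ≤ C/δ²`
(namely `χ(t) = cutoff (a/δ) (t/δ)`). [folklore] -/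
theorem trial_exists_plateau :
    ∃ C : ℝ, 0 < C ∧ ∀ a δ : ℝ, 0 < δ → ∃ χ : ℝ → ℝ, ContDiff ℝ ∞ χ ∧ (∀ t, χ (-t) = χ t) ∧
      (∀ t, 0 ≤ χ t) ∧ (∀ t, χ t ≤ 1) ∧ (∀ t, |t| ≤ a - δ → χ t = 1) ∧ (∀ t, a ≤ |t| → χ t = 0) ∧
      (∀ t, |deriv χ t| ≤ C / δ) ∧ ∀ t, |deriv (deriv χ) t| ≤ C / δ ^ 2 := by
  obtain ⟨D, hD0, hD1, hD2⟩ := trial_exists_bound_deriv_deriv_cutoff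
  refine ⟨D + 1, by positivity, fun a δ hδ ↦ ?_⟩
  set R : ℝ := a / δ with hR
  set c : ℝ := δ⁻¹ with hc
  have hcpos : 0 < c := inv_pos.2 hδ
  have habs : ∀ t, |t * c| = |t| / δ := fun t ↦ by
    rw [abs_mul, abs_of_pos hcpos, hc, div_eq_mul_inv]
  -- first derivative
  have hχd : ∀ t, HasDerivAt (fun x ↦ cutoff R (x * c)) (deriv (cutoff R) (t * c) * c) t := by
    intro t
    have h := ((contDiff_cutoff R (n := 1)).differentiable (by simp) (t * c)).hasDerivAt.comp t
      (hasDerivAt_mul_const c)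
    simpa [Function.comp_def] using h
  have hderiv : deriv (fun x ↦ cutoff R (x * c)) = fun t ↦ deriv (cutoff R) (t * c) * c :=
    funext fun t ↦ (hχd t).deriv
  -- second derivative
  have hχdd : ∀ t, HasDerivAt (fun x ↦ deriv (cutoff R) (x * c) * c)
      (deriv (deriv (cutoff R)) (t * c) * c * c) t := by
    intro t
    have h := ((trial_hasDerivAt_deriv_cutoff R (t * c)).comp t (hasDerivAt_mul_const c)).mul_const c
    rw [(trial_hasDerivAt_deriv_cutoff R (t * c)).deriv]
    simpa [Function.comp_def] using h
  refine ⟨fun t ↦ cutoff R (t * c), (contDiff_cutoff R).comp (contDiff_id.mul contDiff_const),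
    fun t ↦ ?_, fun t ↦ cutoff_nonneg _ _, fun t ↦ cutoff_le_one _ _, fun t ht ↦ ?_, fun t ht ↦ ?_,
    fun t ↦ ?_, fun t ↦ ?_⟩
  · -- evenness
    simp only [cutoff, neg_mul]
    rw [show -(t * c) + R = R - t * c by ring, show R - -(t * c) = t * c + R by ring, mul_comm]
  · -- plateau
    refine cutoff_eq_one ?_
    rw [habs, hR, div_le_iff₀ hδ, sub_mul, div_mul_cancel₀ _ hδ.ne', one_mul]
    exact ht
  · -- support
    refine cutoff_eq_zero ?_
    rw [habs, hR]
    exact div_le_div_of_nonneg_right ht hδ.le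
  · -- `|χ'| ≤ (D + 1)/δ`
    rw [hderiv, abs_mul, abs_of_pos hcpos, hc, ← div_eq_mul_inv]
    exact div_le_div_of_nonneg_right ((hD1 R _).trans (by linarith)) hδ.le
  · -- `|χ''| ≤ (D + 1)/δ²`
    rw [hderiv, (hχdd t).deriv, abs_mul, abs_mul, abs_of_pos hcpos, hc, mul_assoc, ← sq, inv_pow,
      ← div_eq_mul_inv]
    exact div_le_div_of_nonneg_right ((hD2 R _).trans (by linarith)) (by positivity)

/-! ## The odd trial function -/

/-- **The odd trial function.** For `η > 0`, a frequency `γ` and a transition width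
`0 < δ ≤ 1/2` there is a constant `C > 0` such that on every window `a ≥ 1` the function
`o(t) = χ(t) sinh(ηt) cos(γt)` — `χ` the smooth even plateau of `trial_exists_plateau` (`= 1` on
`|t| ≤ a - δ`, `= 0` on `|t| ≥ a`) — is a real-valued odd Weil test function supported in
`[-a, a]`, nonzero in `L²`, with `∫ |o| ≤ 2a sinh(ηa)` and `∫ |o''| ≤ C a cosh(ηa)`
(`o'' = χ'' s + 2χ' s' + χ s''` with `s = sinh(η·) cos(γ·)`, `|s|, |s'|/(η+|γ|), |s''|/(η+|γ|)²`
all `≤ cosh(ηt)`). [folklore] -/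
theorem trial_exists_oddTest_basic :
    ∀ (η δ γ : ℝ), 0 < η → 0 < δ → δ ≤ 1 / 2 → ∃ C : ℝ, 0 < C ∧ ∀ a : ℝ, 1 ≤ a →
      ∃ χ : ℝ → ℝ, ∃ o : ℝ → ℂ,
      (∀ t, o t = ((χ t * (Real.sinh (η * t) * Real.cos (γ * t)) : ℝ) : ℂ)) ∧
      (∀ t, 0 ≤ χ t) ∧ (∀ t, χ t ≤ 1) ∧ (∀ t, |t| ≤ a - δ → χ t = 1) ∧
      (∀ t, a ≤ |t| → χ t = 0) ∧ (∀ t, χ (-t) = χ t) ∧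
      IsWeilTest o ∧ tsupport o ⊆ Set.Icc (-a) a ∧ (∀ t, o (-t) = -o t) ∧ (∀ t, (o t).im = 0) ∧
      0 < ∫ t, ‖o t‖ ^ 2 ∧
      ∫ t, ‖o t‖ ≤ 2 * a * Real.sinh (η * a) ∧
      ∫ t, ‖deriv (deriv o) t‖ ≤ C * a * Real.cosh (η * a) := by
  intro η δ γ hη hδ hδ1
  obtain ⟨Cχ, hCχ, hplat⟩ := trial_exists_plateau
  set L : ℝ := η + |γ| with hL
  set Cf : ℝ := Cχ / δ ^ 2 + 2 * (Cχ / δ) * L + L ^ 2 with hCf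
  refine ⟨2 * Cf, by positivity, fun a ha ↦ ?_⟩
  have ha0 : 0 < a := by linarith
  obtain ⟨χ, hχs, hχev, hχ0, hχ1, hχin, hχout, hχd1, hχd2⟩ := hplat a δ hδ
  -- three elementary tools
  have abs_mul_le_of : ∀ {x y X Y : ℝ}, |x| ≤ X → |y| ≤ Y → 0 ≤ X → |x * y| ≤ X * Y :=
    fun hx hy hX ↦ by
      rw [abs_mul]
      exact mul_le_mul hx hy (abs_nonneg _) hX
  have abs_sinh_le_cosh' : ∀ x : ℝ, |Real.sinh x| ≤ Real.cosh x := fun x ↦ by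
    have h1 := Real.cosh_sq x
    have h2 := Real.cosh_pos x
    rw [abs_le]
    constructor <;> nlinarith
  have sinh_cosh_window : ∀ {t : ℝ}, |t| ≤ a →
      |Real.sinh (η * t)| ≤ Real.sinh (η * a) ∧ Real.cosh (η * t) ≤ Real.cosh (η * a) :=
    fun ht ↦ ⟨trial_abs_sinh_le_window hη ht, by
      simpa only [abs_of_pos hη] using trial_cosh_le_cosh_window (η := η) ht⟩
  -- the elementary factor `s(t) = sinh(ηt) cos(γt)` and its first two derivatives
  set S : ℝ → ℝ := fun t ↦ Real.sinh (η * t) * Real.cos (γ * t) with hS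
  set S₁ : ℝ → ℝ := fun t ↦ Real.cosh (η * t) * η * Real.cos (γ * t) +
    Real.sinh (η * t) * (-Real.sin (γ * t) * γ) with hS₁
  set S₂ : ℝ → ℝ := fun t ↦ Real.sinh (η * t) * η * η * Real.cos (γ * t) +
      Real.cosh (η * t) * η * (-Real.sin (γ * t) * γ) +
    (Real.cosh (η * t) * η * (-Real.sin (γ * t) * γ) +
      Real.sinh (η * t) * (-(Real.cos (γ * t) * γ) * γ)) with hS₂
  have hSd : ∀ t, HasDerivAt S (S₁ t) t := fun t ↦
    (trial_hasDerivAt_const_mul η t).sinh.fun_mul (trial_hasDerivAt_const_mul γ t).cos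
  have hS₁d : ∀ t, HasDerivAt S₁ (S₂ t) t := fun t ↦
    (((trial_hasDerivAt_const_mul η t).cosh.mul_const η).fun_mul (trial_hasDerivAt_const_mul γ t).cos).fun_add
      ((trial_hasDerivAt_const_mul η t).sinh.fun_mul (((trial_hasDerivAt_const_mul γ t).sin.neg).mul_const γ))
  have hcos1 : ∀ x, |Real.cos x| ≤ 1 := Real.abs_cos_le_one
  have hsin1 : ∀ x, |-Real.sin x * γ| ≤ 1 * |γ| := fun x ↦
    abs_mul_le_of (by rw [abs_neg]; exact Real.abs_sin_le_one x) le_rfl zero_le_one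
  have hch : ∀ t, 0 < Real.cosh (η * t) := fun t ↦ Real.cosh_pos _
  have hSb : ∀ t, |S t| ≤ Real.cosh (η * t) := fun t ↦ by
    have h := abs_mul_le_of (abs_sinh_le_cosh' (η * t)) (hcos1 (γ * t)) (hch t).le
    rw [mul_one] at h
    exact h
  have hcoshη : ∀ t, |Real.cosh (η * t) * η| ≤ Real.cosh (η * t) * η := fun t ↦
    (abs_of_pos (mul_pos (hch t) hη)).le
  have hS₁b : ∀ t, |S₁ t| ≤ L * Real.cosh (η * t) := fun t ↦ by
    have e1 := abs_mul_le_of (hcoshη t) (hcos1 (γ * t)) (by positivity)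
    have e2 := abs_mul_le_of (abs_sinh_le_cosh' (η * t)) (hsin1 (γ * t)) (hch t).le
    calc |S₁ t| ≤ _ := abs_add_le _ _
      _ ≤ Real.cosh (η * t) * η * 1 + Real.cosh (η * t) * (1 * |γ|) := add_le_add e1 e2
      _ = L * Real.cosh (η * t) := by rw [hL]; ring
  have hS₂b : ∀ t, |S₂ t| ≤ L ^ 2 * Real.cosh (η * t) := fun t ↦ by
    have e1 : |Real.sinh (η * t) * η * η * Real.cos (γ * t)| ≤ Real.cosh (η * t) * η * η * 1 := by
      refine abs_mul_le_of ?_ (hcos1 _) (by positivity)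
      rw [abs_mul, abs_mul, abs_of_pos hη]
      exact mul_le_mul_of_nonneg_right (mul_le_mul_of_nonneg_right (abs_sinh_le_cosh' _) hη.le)
        hη.le
    have e2 := abs_mul_le_of (hcoshη t) (hsin1 (γ * t)) (by positivity)
    have e4 : |Real.sinh (η * t) * (-(Real.cos (γ * t) * γ) * γ)| ≤ Real.cosh (η * t) * (|γ| * |γ|) := by
      refine abs_mul_le_of (abs_sinh_le_cosh' _) ?_ (hch t).le
      rw [abs_mul, abs_neg, abs_mul]
      exact mul_le_mul_of_nonneg_right (mul_le_of_le_one_left (abs_nonneg _) (hcos1 _))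
        (abs_nonneg _)
    calc |S₂ t| ≤ _ := abs_add_le _ _
      _ ≤ (Real.cosh (η * t) * η * η * 1 + Real.cosh (η * t) * η * (1 * |γ|)) +
          (Real.cosh (η * t) * η * (1 * |γ|) + Real.cosh (η * t) * (|γ| * |γ|)) :=
        add_le_add ((abs_add_le _ _).trans (add_le_add e1 e2))
          ((abs_add_le _ _).trans (add_le_add e2 e4))
      _ = L ^ 2 * Real.cosh (η * t) := by rw [hL]; ring
  -- the real trial function `f = χ s` and its derivatives
  have hχ's : ContDiff ℝ ∞ (deriv χ) := hχs.deriv'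
  have hχd : ∀ t, HasDerivAt χ (deriv χ t) t := fun t ↦ (hχs.differentiable (by simp) t).hasDerivAt
  have hχ'd : ∀ t, HasDerivAt (deriv χ) (deriv (deriv χ) t) t := fun t ↦
    (hχ's.differentiable (by simp) t).hasDerivAt
  set f : ℝ → ℝ := fun t ↦ χ t * S t with hf
  set f₁ : ℝ → ℝ := fun t ↦ deriv χ t * S t + χ t * S₁ t with hf₁
  set f₂ : ℝ → ℝ := fun t ↦ deriv (deriv χ) t * S t + deriv χ t * S₁ t +
    (deriv χ t * S₁ t + χ t * S₂ t) with hf₂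
  have hfd : ∀ t, HasDerivAt f (f₁ t) t := fun t ↦ (hχd t).fun_mul (hSd t)
  have hf₁d : ∀ t, HasDerivAt f₁ (f₂ t) t := fun t ↦
    ((hχ'd t).fun_mul (hSd t)).fun_add ((hχd t).fun_mul (hS₁d t))
  have hf₂b : ∀ t, |f₂ t| ≤ Cf * Real.cosh (η * t) := fun t ↦ by
    have hχabs : |χ t| ≤ 1 := by rw [abs_of_nonneg (hχ0 t)]; exact hχ1 t
    have e1 := abs_mul_le_of (hχd2 t) (hSb t) (by positivity)
    have e2 := abs_mul_le_of (hχd1 t) (hS₁b t) (by positivity)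
    have e3 := abs_mul_le_of hχabs (hS₂b t) zero_le_one
    calc |f₂ t| ≤ _ := abs_add_le _ _
      _ ≤ (Cχ / δ ^ 2 * Real.cosh (η * t) + Cχ / δ * (L * Real.cosh (η * t))) +
          (Cχ / δ * (L * Real.cosh (η * t)) + 1 * (L ^ 2 * Real.cosh (η * t))) :=
        add_le_add ((abs_add_le _ _).trans (add_le_add e1 e2))
          ((abs_add_le _ _).trans (add_le_add e2 e3))
      _ = Cf * Real.cosh (η * t) := by rw [hCf]; ring
  -- vanishing off the window
  have hout : ∀ t, t ∉ Icc (-a) a → a ≤ |t| := fun t ht ↦ by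
    simp only [mem_Icc, not_and_or, not_le] at ht
    rcases ht with h | h
    · have : a < -t := by linarith
      exact this.le.trans (neg_le_abs t)
    · exact h.le.trans (le_abs_self t)
  have hf0 : ∀ t, t ∉ Icc (-a) a → f t = 0 := fun t ht ↦ by
    simp only [hf, hχout t (hout t ht), zero_mul]
  -- the complex-valued test function
  set o : ℝ → ℂ := fun t ↦ ((f t : ℝ) : ℂ) with ho
  have hod : ∀ t, HasDerivAt o ((f₁ t : ℝ) : ℂ) t := fun t ↦ (hfd t).ofReal_comp
  have hdo : deriv o = fun t ↦ ((f₁ t : ℝ) : ℂ) := funext fun t ↦ (hod t).deriv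
  have hodd : ∀ t, HasDerivAt (deriv o) ((f₂ t : ℝ) : ℂ) t := by
    rw [hdo]
    exact fun t ↦ (hf₁d t).ofReal_comp
  have hddo : deriv (deriv o) = fun t ↦ ((f₂ t : ℝ) : ℂ) := funext fun t ↦ (hodd t).deriv
  have hSs : ContDiff ℝ ∞ S := by
    rw [hS]
    fun_prop
  have hoW : IsWeilTest o :=
    ⟨Complex.ofRealCLM.contDiff.comp (hχs.mul hSs),
      HasCompactSupport.intro (K := Icc (-a) a) isCompact_Icc fun t ht ↦ by
        simp only [ho, hf0 t ht, Complex.ofReal_zero]⟩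
  have hsupp : tsupport o ⊆ Icc (-a) a :=
    closure_minimal (Function.support_subset_iff'.2 fun t ht ↦ by
      simp only [ho, hf0 t ht, Complex.ofReal_zero]) isClosed_Icc
  have hnorm : ∀ t, ‖o t‖ = |f t| := fun t ↦ by
    simp only [ho, Complex.norm_real, Real.norm_eq_abs]
  have hvol : volume.real (Icc (-a) a) = 2 * a := by
    rw [Real.volume_real_Icc_of_le (by linarith)]
    ring
  refine ⟨χ, o, fun t ↦ rfl, hχ0, hχ1, hχin, hχout, hχev, hoW, hsupp, fun t ↦ ?_, fun t ↦ ?_, ?_,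
    ?_, ?_⟩
  · -- odd
    simp only [ho, hf, hS, hχev, mul_neg, Real.sinh_neg, Real.cos_neg, neg_mul]
    push_cast
    ring
  · -- real-valued
    simp only [ho, Complex.ofReal_im]
  · -- nonzero in `L²`
    have hnn : 0 ≤ ∫ t, ‖o t‖ ^ 2 := integral_nonneg fun _ ↦ by positivity
    rcases hnn.eq_or_lt with hz | hpos
    · exfalso
      set t₀ : ℝ := min (1 / 2) (1 / (|γ| + 1)) with ht₀
      have ht₀pos : 0 < t₀ := lt_min (by norm_num) (by positivity)
      have ht₀le : t₀ ≤ 1 / 2 := min_le_left _ _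
      have hχt₀ : χ t₀ = 1 := hχin t₀ (by rw [abs_of_pos ht₀pos]; linarith)
      have hsinh : 0 < Real.sinh (η * t₀) := Real.sinh_pos_iff.2 (by positivity)
      have hγt₀ : |γ * t₀| < 1 := by
        rw [abs_mul, abs_of_pos ht₀pos]
        have h1 : |γ| * t₀ ≤ |γ| * (1 / (|γ| + 1)) :=
          mul_le_mul_of_nonneg_left (min_le_right _ _) (abs_nonneg _)
        have h2 : |γ| * (1 / (|γ| + 1)) < 1 := by
          rw [mul_one_div, div_lt_one (by positivity)]
          linarith
        linarith
      have hcos : 0 < Real.cos (γ * t₀) := by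
        refine Real.cos_pos_of_mem_Ioo ⟨?_, ?_⟩ <;>
          nlinarith [abs_lt.1 hγt₀, Real.pi_gt_three]
      have hft₀ : f t₀ ≠ 0 := by
        simp only [hf, hS, hχt₀, one_mul]
        exact (mul_pos hsinh hcos).ne'
      have h0 : o = 0 := hoW.eq_zero_of_integral_norm_sq_eq_zero hz.symm
      have : o t₀ = 0 := by rw [h0, Pi.zero_apply]
      simp only [ho, Complex.ofReal_eq_zero] at this
      exact hft₀ this
    · exact hpos
  · -- `∫ |o| ≤ 2a sinh(ηa)`
    rw [← setIntegral_eq_integral_of_forall_compl_eq_zero (s := Icc (-a) a)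
      (fun t ht ↦ by rw [hnorm, hf0 t ht, abs_zero])]
    have hb : ∀ t ∈ Icc (-a) a, ‖‖o t‖‖ ≤ Real.sinh (η * a) := fun t ht ↦ by
      rw [norm_norm, hnorm, hf, abs_mul, abs_of_nonneg (hχ0 t)]
      have hta : |t| ≤ a := abs_le.2 ⟨ht.1, ht.2⟩
      calc χ t * |S t| ≤ 1 * |S t| := mul_le_mul_of_nonneg_right (hχ1 t) (abs_nonneg _)
        _ ≤ 1 * (Real.sinh (η * a) * 1) := by
            refine mul_le_mul_of_nonneg_left ?_ zero_le_one
            exact abs_mul_le_of (sinh_cosh_window hta).1 (hcos1 _)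
              (Real.sinh_nonneg_iff.2 (by positivity))
        _ = Real.sinh (η * a) := by ring
    have h := norm_setIntegral_le_of_norm_le_const (measure_Icc_lt_top (μ := volume)) hb
    rw [hvol] at h
    exact (Real.le_norm_self _).trans (h.trans (by ring_nf; rfl))
  · -- `∫ |o''| ≤ 2 Cf a cosh(ηa)`
    have hts : tsupport (deriv (deriv o)) ⊆ Icc (-a) a :=
      (tsupport_deriv_subset.trans tsupport_deriv_subset).trans hsupp
    rw [← setIntegral_eq_integral_of_forall_compl_eq_zero (s := Icc (-a) a)
      (fun t ht ↦ by rw [image_eq_zero_of_notMem_tsupport fun h ↦ ht (hts h), norm_zero])]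
    have hb : ∀ t ∈ Icc (-a) a, ‖‖deriv (deriv o) t‖‖ ≤ Cf * Real.cosh (η * a) := fun t ht ↦ by
      rw [norm_norm, hddo, Complex.norm_real, Real.norm_eq_abs]
      have hta : |t| ≤ a := abs_le.2 ⟨ht.1, ht.2⟩
      exact (hf₂b t).trans (mul_le_mul_of_nonneg_left (sinh_cosh_window hta).2 (by positivity))
    have h := norm_setIntegral_le_of_norm_le_const (measure_Icc_lt_top (μ := volume)) hb
    rw [hvol] at h
    exact (Real.le_norm_self _).trans (h.trans (by ring_nf; rfl))

end Summit.RiemannHypothesis.RiemannHypothesis.Theorems.WeilParityOffLineParityDetection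

end
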